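import Mathlib
import HarnessLib
import Literature.Analysis.FluidPDE.VectorCalculus
import Summits.NavierStokesRegularity.NavierStokesRegularity.Theorems.UnthreadedDoorAntidynamoWallShellMean

/-!
# Route `UnthreadedDoor` / `ThreadingFlux`, crux `PoloidalLiouville` (stmt-NavierStokesRegularity-1222), antidynamo v2 skeleton
# (sha16 `4ebf5683127b`), WALL `stub_scalarLiouville`: the WEIGHTED SHELL-OSCILLATION BOUND for the toroidal potential, file 2/2 —
# great circles, arbitrary pairs of directions, and the `O(V/R)` consequences

Support file (seat leafhand-ns-unthreadeddoor-2 g5, cell decomp-ns), `--supports stmt-NavierStokesRegularity-1222 --as helper`; theorems only.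
Continues `…Theorems.UnthreadedDoorAntidynamoWallShellMean` (file 1/2: the potential `φ` of the curl-free `v − T·(x − x₀)`, FTC along radial
segments and sphere arcs, the sector-loop identity and the bound for a unit-speed arc `γ` with `γ 0 = n`).

THIS FILE.  §5a great circles `γ(s) = cos s · n + sin s · e` (orthonormal `n, e`): differentiable unit curves of unit speed with `γ(0) = n`;
every pair of unit vectors `n, n'` is joined by such an arc of length `θ = arccos ⟪n, n'⟫ ≤ π` (`exists_greatCircle_through`).  §5b the bounds in
the wall's slice vocabulary (`v ∈ C^∞`, `‖v‖ ≤ V`, `T ∈ C^∞(ℝ³ ∖ {x₀})`, `curl v = ∇T × (x − x₀)` off `x₀`):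

* ★ `weightedShell_oscillation_le` — `|∫_{R₁}^{R₂} r (T(x₀ + rn) − T(x₀ + r(cos θ n + sin θ e))) dr| ≤ 2V(R₂ − R₁) + Vθ(R₁ + R₂)`;
* ★★ `weightedShell_oscillation_le_pi` — for arbitrary unit `n, n'`: `… ≤ 2V(R₂ − R₁) + πV(R₁ + R₂)`;
* ★ `le_of_weightedShell_ge` — if `T(x₀ + rn) − T(x₀ + rn') ≥ μ` on `r ∈ [R₁, R₂]` then `μ R₁ (R₂ − R₁) ≤ 2V(R₂ − R₁) + πV(R₁ + R₂)`;
* ★ `le_div_of_dyadicShell_ge` — on a dyadic shell `[R, 2R]`: `μ ≤ (2 + 3π) V / R`.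

READING.  The tangential oscillation of the potential is `O(1)` pointwise (`osc_{S_r} T ≤ π sup ‖curl v‖`), but a SIGN-COHERENT tangential
oscillation cannot persist radially: the non-radial part of `T` is radially mean-free at infinity at rate `O(V/R)`, uniformly in the pair of
directions — the poloidal analogue of the obstruction `|ϖ · (ω_θ/ϖ)| ≤ C` that pairs with the spread of positivity (KNSS 2009 Lemma 2.1, tree
`KNSS2009_lemma21_halfball`) in KNSS's Theorem 5.2.

HONEST LABEL: slice-wise KINEMATICS of the wall's class; nothing here proves `stub_scalarLiouville`, `PoloidalLiouville` (1222) or bears on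
Navier–Stokes regularity; no summit statement is proved. [folklore]
[cite: KochNadirashviliSereginSverak2009, Thm 5.2 and Lemma 2.1 (arXiv:0709.3599 pp. 5, 9–10)]
-/

noncomputable section

-- the summit and its single sub-problem share the name (CONVENTIONS §1)
set_option linter.dupNamespace false

open scoped Topology InnerProductSpace RealInnerProductSpace ContDiff
open Filter Set Function Metric MeasureTheory intervalIntegral
open Literature.Analysis.FluidPDE

namespace Summit.NavierStokesRegularity.NavierStokesRegularity.Theorems.PoloidalLiouville.Antidynamo

namespace ShellMean

/-! ### §5 Great circles, and the bounds for arbitrary pairs of directions -/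

/-- ★ **Great circles.**  For orthonormal `n, e`, `γ(s) = cos s · n + sin s · e` is a differentiable unit curve with continuous unit
velocity `γ′(s) = −sin s · n + cos s · e`, `γ(0) = n`. [folklore] -/
theorem greatCircle {n e : EuclideanSpace ℝ (Fin 3)} (hn : ‖n‖ = 1) (he : ‖e‖ = 1) (hne : ⟪n, e⟫ = 0) :
    Differentiable ℝ (fun s : ℝ => Real.cos s • n + Real.sin s • e) ∧
      Continuous (deriv fun s : ℝ => Real.cos s • n + Real.sin s • e) ∧
      (∀ s, ‖Real.cos s • n + Real.sin s • e‖ = 1) ∧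
      (∀ s, ‖deriv (fun s : ℝ => Real.cos s • n + Real.sin s • e) s‖ ≤ 1) ∧
      (Real.cos 0 • n + Real.sin 0 • e = n) := by
  have hd : ∀ s, HasDerivAt (fun s : ℝ => Real.cos s • n + Real.sin s • e)
      ((-Real.sin s) • n + Real.cos s • e) s := fun s =>
    ((Real.hasDerivAt_cos s).smul_const n).add ((Real.hasDerivAt_sin s).smul_const e)
  have hderiv : deriv (fun s : ℝ => Real.cos s • n + Real.sin s • e) =
      fun s => (-Real.sin s) • n + Real.cos s • e := funext fun s => (hd s).deriv
  -- `‖a n + b e‖² = a² + b²` for the orthonormal pair (the tree's `PalasekTowerClayBridge.norm_sq_frame` computes the same; inlined here)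
  have hns : ∀ a b : ℝ, ‖a • n + b • e‖ ^ 2 = a ^ 2 + b ^ 2 := fun a b => by
    rw [norm_add_sq_real, norm_smul, norm_smul, hn, he, inner_smul_left, inner_smul_right, hne]
    simp [sq_abs]
  have hunit : ∀ a b : ℝ, a ^ 2 + b ^ 2 = 1 → ‖a • n + b • e‖ = 1 := by
    intro a b hab
    have h2 : ‖a • n + b • e‖ ^ 2 = 1 := by rw [hns, hab]
    have h0 : 0 ≤ ‖a • n + b • e‖ := norm_nonneg _
    nlinarith
  refine ⟨fun s => (hd s).differentiableAt, ?_, fun s => hunit _ _ (Real.cos_sq_add_sin_sq s), fun s => ?_, by simp⟩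
  · rw [hderiv]
    exact ((Real.continuous_sin.neg).smul continuous_const).add (Real.continuous_cos.smul continuous_const)
  · rw [hderiv]
    exact (hunit _ _ (by rw [neg_sq]; exact Real.sin_sq_add_cos_sq s)).le

/-- ★ **Every pair of unit vectors is joined by a great-circle arc of length `≤ π`**: for unit `n, n'` there are a unit `e ⊥ n` and
`θ ∈ [0, π]` with `n' = cos θ · n + sin θ · e`. [folklore] -/
theorem exists_greatCircle_through {n n' : EuclideanSpace ℝ (Fin 3)} (hn : ‖n‖ = 1) (hn' : ‖n'‖ = 1) :
    ∃ e : EuclideanSpace ℝ (Fin 3), ∃ θ : ℝ, ‖e‖ = 1 ∧ ⟪n, e⟫ = 0 ∧ 0 ≤ θ ∧ θ ≤ Real.pi ∧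
      n' = Real.cos θ • n + Real.sin θ • e := by
  set c : ℝ := ⟪n, n'⟫ with hc
  set u : EuclideanSpace ℝ (Fin 3) := n' - c • n with hu
  have hcabs : |c| ≤ 1 := by
    have h := abs_real_inner_le_norm n n'
    rw [hn, hn', mul_one] at h
    exact h
  have hc1 : -1 ≤ c := (abs_le.mp hcabs).1
  have hc2 : c ≤ 1 := (abs_le.mp hcabs).2
  have hnu : ⟪n, u⟫ = 0 := by
    rw [hu, inner_sub_right, inner_smul_right, real_inner_self_eq_norm_sq, hn]; simp [hc]
  have hu2 : ‖u‖ ^ 2 = 1 - c ^ 2 := by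
    have h : ‖n'‖ ^ 2 = ‖c • n + u‖ ^ 2 := by rw [hu]; congr 1; abel
    rw [norm_add_sq_real, norm_smul, hn, mul_one, Real.norm_eq_abs, sq_abs, inner_smul_left, hnu, hn'] at h
    simp at h
    linarith
  -- `θ = arccos c`, `sin θ = √(1 − c²) = ‖u‖`
  set θ : ℝ := Real.arccos c with hθ
  have hcos : Real.cos θ = c := Real.cos_arccos hc1 hc2
  have hsin : Real.sin θ = ‖u‖ := by
    rw [hθ, Real.sin_arccos]
    have h0 : 0 ≤ ‖u‖ := norm_nonneg u
    rw [← hu2, Real.sqrt_sq h0]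
  by_cases hu0 : u = 0
  · -- `n' = ± n`: any unit vector orthogonal to `n` will do
    have hnorm0 : ‖u‖ = 0 := by rw [hu0, norm_zero]
    -- a unit vector orthogonal to `n`: normalise the component of `e₀` or `e₁` orthogonal to `n`
    obtain ⟨w, hw⟩ : ∃ w : EuclideanSpace ℝ (Fin 3), w - ⟪n, w⟫ • n ≠ 0 := by
      by_contra h
      push Not at h
      have h0 := h (EuclideanSpace.single 0 1)
      have h1 := h (EuclideanSpace.single 1 1)
      rw [sub_eq_zero] at h0 h1
      -- `e₀` and `e₁` would both be multiples of `n`, hence not orthogonal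
      have horth : ⟪(EuclideanSpace.single 0 (1 : ℝ) : EuclideanSpace ℝ (Fin 3)), EuclideanSpace.single 1 (1 : ℝ)⟫ = 0 := by
        simp [EuclideanSpace.inner_single_left]
      rw [h0, h1, inner_smul_left, inner_smul_right, real_inner_self_eq_norm_sq, hn] at horth
      simp at horth
      -- one of the two coefficients vanishes, so `e₀ = 0` or `e₁ = 0`: absurd
      rcases horth with h | h
      · rw [h, zero_smul] at h0
        have := congrArg (fun z : EuclideanSpace ℝ (Fin 3) => z 0) h0
        simp at this
      · rw [h, zero_smul] at h1
        have := congrArg (fun z : EuclideanSpace ℝ (Fin 3) => z 1) h1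
        simp at this
    set e : EuclideanSpace ℝ (Fin 3) := ‖w - ⟪n, w⟫ • n‖⁻¹ • (w - ⟪n, w⟫ • n) with he
    have hwn : 0 < ‖w - ⟪n, w⟫ • n‖ := norm_pos_iff.mpr hw
    refine ⟨e, θ, ?_, ?_, Real.arccos_nonneg c, Real.arccos_le_pi c, ?_⟩
    · rw [he, norm_smul, norm_inv, norm_norm, inv_mul_cancel₀ hwn.ne']
    · rw [he, inner_smul_right, inner_sub_right, inner_smul_right, real_inner_self_eq_norm_sq, hn]; simp
    · rw [hsin, hnorm0, zero_smul, add_zero, hcos]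
      have : n' - c • n = 0 := by rw [← hu]; exact hu0
      rw [sub_eq_zero] at this
      exact this
  · set e : EuclideanSpace ℝ (Fin 3) := ‖u‖⁻¹ • u with he
    have hupos : 0 < ‖u‖ := norm_pos_iff.mpr hu0
    refine ⟨e, θ, ?_, ?_, Real.arccos_nonneg c, Real.arccos_le_pi c, ?_⟩
    · rw [he, norm_smul, norm_inv, norm_norm, inv_mul_cancel₀ hupos.ne']
    · rw [he, inner_smul_right, hnu, mul_zero]
    · rw [hcos, hsin, he, smul_smul, mul_inv_cancel₀ hupos.ne', one_smul, hu]
      abel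

/-- ★★ **The weighted shell-oscillation bound (orthonormal-frame form).**  Let `v ∈ C^∞(ℝ³; ℝ³)` with `‖v‖ ≤ V`, `T ∈ C^∞(ℝ³ ∖ {x₀})`,
and `curl v = ∇T × (x − x₀)` off `x₀` (the slice of the wall's class).  For orthonormal `n, e`, `θ ≥ 0` and `0 < R₁ ≤ R₂`:
`|∫_{R₁}^{R₂} r (T(x₀ + rn) − T(x₀ + r(cos θ n + sin θ e))) dr| ≤ 2V(R₂ − R₁) + Vθ(R₁ + R₂)`. [folklore] -/
theorem weightedShell_oscillation_le {v : EuclideanSpace ℝ (Fin 3) → EuclideanSpace ℝ (Fin 3)}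
    {T : EuclideanSpace ℝ (Fin 3) → ℝ} {x₀ : EuclideanSpace ℝ (Fin 3)} {V : ℝ}
    (hv : ContDiff ℝ (⊤ : ℕ∞) v) (hV : ∀ x, ‖v x‖ ≤ V) (hT : ContDiffOn ℝ (⊤ : ℕ∞) T {x₀}ᶜ)
    (hcurl : ∀ x, x ≠ x₀ → curl v x = cross (gradient T x) (x - x₀))
    {n e : EuclideanSpace ℝ (Fin 3)} (hn : ‖n‖ = 1) (he : ‖e‖ = 1) (hne : ⟪n, e⟫ = 0)
    {θ R₁ R₂ : ℝ} (hθ : 0 ≤ θ) (hR₁ : 0 < R₁) (hR : R₁ ≤ R₂) :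
    |∫ r in R₁..R₂, r * (T (x₀ + r • n) - T (x₀ + r • (Real.cos θ • n + Real.sin θ • e)))|
      ≤ 2 * V * (R₂ - R₁) + V * θ * (R₁ + R₂) := by
  obtain ⟨φ, hφ⟩ := exists_potential hv hT hcurl
  obtain ⟨hγd, hγc, hγ1, hγ', hγ0⟩ := greatCircle hn he hne
  have h := weightedShell_oscillation_le_of_arc hv.continuous hV hT.continuousOn hφ hγd hγc hγ1 hγ' hR₁ hR hθ
  rw [hγ0] at h
  exact h

/-- ★★ **The weighted shell-oscillation bound for an arbitrary pair of directions**: for unit `n, n'` and `0 < R₁ ≤ R₂`,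
`|∫_{R₁}^{R₂} r (T(x₀ + rn) − T(x₀ + rn')) dr| ≤ 2V(R₂ − R₁) + πV(R₁ + R₂)`. [folklore] -/
theorem weightedShell_oscillation_le_pi {v : EuclideanSpace ℝ (Fin 3) → EuclideanSpace ℝ (Fin 3)}
    {T : EuclideanSpace ℝ (Fin 3) → ℝ} {x₀ : EuclideanSpace ℝ (Fin 3)} {V : ℝ}
    (hv : ContDiff ℝ (⊤ : ℕ∞) v) (hV : ∀ x, ‖v x‖ ≤ V) (hT : ContDiffOn ℝ (⊤ : ℕ∞) T {x₀}ᶜ)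
    (hcurl : ∀ x, x ≠ x₀ → curl v x = cross (gradient T x) (x - x₀))
    {n n' : EuclideanSpace ℝ (Fin 3)} (hn : ‖n‖ = 1) (hn' : ‖n'‖ = 1) {R₁ R₂ : ℝ} (hR₁ : 0 < R₁) (hR : R₁ ≤ R₂) :
    |∫ r in R₁..R₂, r * (T (x₀ + r • n) - T (x₀ + r • n'))| ≤ 2 * V * (R₂ - R₁) + Real.pi * V * (R₁ + R₂) := by
  obtain ⟨e, θ, he, hne, hθ0, hθπ, hrep⟩ := exists_greatCircle_through hn hn'
  have h := weightedShell_oscillation_le hv hV hT hcurl hn he hne hθ0 hR₁ hR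
  rw [← hrep] at h
  have hV0 : 0 ≤ V := le_trans (norm_nonneg _) (hV 0)
  have hmono : V * θ * (R₁ + R₂) ≤ Real.pi * V * (R₁ + R₂) := by
    have : V * θ ≤ Real.pi * V := by nlinarith
    exact mul_le_mul_of_nonneg_right this (by linarith)
  linarith

/-- ★ **Consequence: a sign-coherent tangential oscillation cannot persist radially.**  If `T(x₀ + rn) − T(x₀ + rn') ≥ μ` for all
`r ∈ [R₁, R₂]` (`0 < R₁ ≤ R₂`, unit `n, n'`), then `μ R₁ (R₂ − R₁) ≤ 2V(R₂ − R₁) + πV(R₁ + R₂)`. [folklore] -/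
theorem le_of_weightedShell_ge {v : EuclideanSpace ℝ (Fin 3) → EuclideanSpace ℝ (Fin 3)}
    {T : EuclideanSpace ℝ (Fin 3) → ℝ} {x₀ : EuclideanSpace ℝ (Fin 3)} {V μ : ℝ}
    (hv : ContDiff ℝ (⊤ : ℕ∞) v) (hV : ∀ x, ‖v x‖ ≤ V) (hT : ContDiffOn ℝ (⊤ : ℕ∞) T {x₀}ᶜ)
    (hcurl : ∀ x, x ≠ x₀ → curl v x = cross (gradient T x) (x - x₀))
    {n n' : EuclideanSpace ℝ (Fin 3)} (hn : ‖n‖ = 1) (hn' : ‖n'‖ = 1) {R₁ R₂ : ℝ} (hR₁ : 0 < R₁) (hR : R₁ ≤ R₂)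
    (hμ : ∀ r ∈ Icc R₁ R₂, μ ≤ T (x₀ + r • n) - T (x₀ + r • n')) :
    μ * R₁ * (R₂ - R₁) ≤ 2 * V * (R₂ - R₁) + Real.pi * V * (R₁ + R₂) := by
  have hb := weightedShell_oscillation_le_pi hv hV hT hcurl hn hn' hR₁ hR
  -- continuity of the integrand on `[R₁, R₂]`
  have hpath : ∀ m : EuclideanSpace ℝ (Fin 3), Continuous fun r : ℝ => x₀ + r • m := fun m =>
    continuous_const.add (continuous_id.smul continuous_const)
  have hTm : ∀ m : EuclideanSpace ℝ (Fin 3), ‖m‖ = 1 → ContinuousOn (fun r : ℝ => T (x₀ + r • m)) (Icc R₁ R₂) := by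
    intro m hm
    refine hT.continuousOn.comp (hpath m).continuousOn fun r hr => ?_
    exact centre_add_smul_ne hm (lt_of_lt_of_le hR₁ hr.1).ne'
  have hcont : ContinuousOn (fun r : ℝ => r * (T (x₀ + r • n) - T (x₀ + r • n'))) (Icc R₁ R₂) :=
    continuousOn_id.mul ((hTm n hn).sub (hTm n' hn'))
  by_cases hμ0 : μ ≤ 0
  · have hV0 : 0 ≤ V := le_trans (norm_nonneg _) (hV 0)
    have h1 : μ * R₁ * (R₂ - R₁) ≤ 0 :=
      mul_nonpos_of_nonpos_of_nonneg (mul_nonpos_of_nonpos_of_nonneg hμ0 hR₁.le) (sub_nonneg.mpr hR)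
    have h2 : 0 ≤ 2 * V * (R₂ - R₁) := mul_nonneg (mul_nonneg two_pos.le hV0) (sub_nonneg.mpr hR)
    have h3 : 0 ≤ Real.pi * V * (R₁ + R₂) := mul_nonneg (mul_nonneg Real.pi_pos.le hV0) (by linarith)
    linarith
  · push Not at hμ0
    -- lower bound of the integral by `∫ μ R₁ = μ R₁ (R₂ − R₁)`
    have hlow : ∫ r in R₁..R₂, μ * R₁ ≤ ∫ r in R₁..R₂, r * (T (x₀ + r • n) - T (x₀ + r • n')) := by
      refine intervalIntegral.integral_mono_on hR intervalIntegrable_const ?_ fun r hr => ?_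
      · exact (hcont.mono (by rw [uIcc_of_le hR])).intervalIntegrable
      · have h1 : μ ≤ T (x₀ + r • n) - T (x₀ + r • n') := hμ r hr
        have h2 : R₁ ≤ r := hr.1
        calc μ * R₁ ≤ μ * r := mul_le_mul_of_nonneg_left h2 hμ0.le
          _ ≤ r * (T (x₀ + r • n) - T (x₀ + r • n')) := by
              rw [mul_comm]; exact mul_le_mul_of_nonneg_left h1 (hR₁.le.trans h2)
    rw [intervalIntegral.integral_const, smul_eq_mul] at hlow
    have habs := le_abs_self (∫ r in R₁..R₂, r * (T (x₀ + r • n) - T (x₀ + r • n')))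
    nlinarith

/-- ★ **Dyadic form: the rate `O(V/R)`.**  If `T(x₀ + rn) − T(x₀ + rn') ≥ μ` for all `r ∈ [R, 2R]` (`R > 0`), then
`μ ≤ (2 + 3π) V / R`. [folklore] -/
theorem le_div_of_dyadicShell_ge {v : EuclideanSpace ℝ (Fin 3) → EuclideanSpace ℝ (Fin 3)}
    {T : EuclideanSpace ℝ (Fin 3) → ℝ} {x₀ : EuclideanSpace ℝ (Fin 3)} {V μ : ℝ}
    (hv : ContDiff ℝ (⊤ : ℕ∞) v) (hV : ∀ x, ‖v x‖ ≤ V) (hT : ContDiffOn ℝ (⊤ : ℕ∞) T {x₀}ᶜ)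
    (hcurl : ∀ x, x ≠ x₀ → curl v x = cross (gradient T x) (x - x₀))
    {n n' : EuclideanSpace ℝ (Fin 3)} (hn : ‖n‖ = 1) (hn' : ‖n'‖ = 1) {R : ℝ} (hR : 0 < R)
    (hμ : ∀ r ∈ Icc R (2 * R), μ ≤ T (x₀ + r • n) - T (x₀ + r • n')) :
    μ ≤ (2 + 3 * Real.pi) * V / R := by
  have h := le_of_weightedShell_ge hv hV hT hcurl hn hn' hR (by linarith) hμ
  rw [le_div_iff₀ hR]
  have h2 : μ * R * (2 * R - R) = (μ * R) * R := by ring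
  rw [h2] at h
  have h3 : 2 * V * (2 * R - R) + Real.pi * V * (R + 2 * R) = ((2 + 3 * Real.pi) * V) * R := by ring
  rw [h3] at h
  exact le_of_mul_le_mul_right h hR

/-! ### §5c The bound in the binder shapes of the wall `StubScalarLiouville` (time-dependent class) -/

/-- ★★ **The weighted shell-oscillation bound, wall binders.**  For `v` jointly smooth on the slab `(−∞,0) × ℝ³` with `‖v(t,x)‖ ≤ V`, `T` jointly
smooth on the punctured slab, and `curl v(t) = ∇T(t) × (x − x₀)` (three of the binders of `Antidynamo.StubScalarLiouville`, plus the pointwise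
velocity bound of the class): at every `t < 0`, for all unit `n, n'` and `0 < R₁ ≤ R₂`,
`|∫_{R₁}^{R₂} r (T(t, x₀ + rn) − T(t, x₀ + rn')) dr| ≤ 2V(R₂ − R₁) + πV(R₁ + R₂)`. [folklore] -/
theorem weightedShell_oscillation_le_of_wall
    {v : ℝ → EuclideanSpace ℝ (Fin 3) → EuclideanSpace ℝ (Fin 3)} {x₀ : EuclideanSpace ℝ (Fin 3)}
    {T : ℝ → EuclideanSpace ℝ (Fin 3) → ℝ} {V : ℝ}
    (hsm : ContDiffOn ℝ (⊤ : ℕ∞) (Function.uncurry v) (Set.Iio 0 ×ˢ Set.univ))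
    (hsT : ContDiffOn ℝ (⊤ : ℕ∞) (Function.uncurry T) (Set.Iio 0 ×ˢ ({x₀}ᶜ : Set (EuclideanSpace ℝ (Fin 3)))))
    (hV : ∀ t < 0, ∀ x, ‖v t x‖ ≤ V)
    (hrep : ∀ t < 0, ∀ x, curl (v t) x = cross (gradient (T t) x) (x - x₀))
    {t : ℝ} (ht : t < 0) {n n' : EuclideanSpace ℝ (Fin 3)} (hn : ‖n‖ = 1) (hn' : ‖n'‖ = 1)
    {R₁ R₂ : ℝ} (hR₁ : 0 < R₁) (hR : R₁ ≤ R₂) :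
    |∫ r in R₁..R₂, r * (T t (x₀ + r • n) - T t (x₀ + r • n'))| ≤ 2 * V * (R₂ - R₁) + Real.pi * V * (R₁ + R₂) := by
  -- slices of jointly smooth maps are smooth
  have hι : ContDiff ℝ (⊤ : ℕ∞) fun x : EuclideanSpace ℝ (Fin 3) => (t, x) := contDiff_prodMk_right t
  have hv : ContDiff ℝ (⊤ : ℕ∞) (v t) :=
    hsm.comp_contDiff hι fun x => ⟨ht, Set.mem_univ x⟩
  have hT : ContDiffOn ℝ (⊤ : ℕ∞) (T t) ({x₀}ᶜ) :=
    hsT.comp hι.contDiffOn fun x hx => ⟨ht, hx⟩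
  exact weightedShell_oscillation_le_pi hv (hV t ht) hT (fun x _ => hrep t ht x) hn hn' hR₁ hR

/-! ### §5d Pointwise dyadic form: every pair of rays carries, in every dyadic shell, a radius where the potentials nearly agree -/

/-- ★ **Dyadic near-agreement along rays.**  In the wall's slice class, for all unit `n, n'` and every `R > 0` there is a radius
`r ∈ [R, 2R]` with `T(x₀ + rn) − T(x₀ + rn') ≤ (2 + 3π) V / R` (contrapositive of `le_div_of_dyadicShell_ge` through the minimum of the
continuous difference on the compact shell; by symmetry in `n, n'` also `≥ −(2 + 3π) V / R` at some radius). [folklore] -/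
theorem exists_mem_Icc_sub_le {v : EuclideanSpace ℝ (Fin 3) → EuclideanSpace ℝ (Fin 3)}
    {T : EuclideanSpace ℝ (Fin 3) → ℝ} {x₀ : EuclideanSpace ℝ (Fin 3)} {V : ℝ}
    (hv : ContDiff ℝ (⊤ : ℕ∞) v) (hV : ∀ x, ‖v x‖ ≤ V) (hT : ContDiffOn ℝ (⊤ : ℕ∞) T {x₀}ᶜ)
    (hcurl : ∀ x, x ≠ x₀ → curl v x = cross (gradient T x) (x - x₀))
    {n n' : EuclideanSpace ℝ (Fin 3)} (hn : ‖n‖ = 1) (hn' : ‖n'‖ = 1) {R : ℝ} (hR : 0 < R) :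
    ∃ r ∈ Icc R (2 * R), T (x₀ + r • n) - T (x₀ + r • n') ≤ (2 + 3 * Real.pi) * V / R := by
  -- the difference is continuous on the compact shell `[R, 2R]`, so it attains its minimum
  have hpath : ∀ m : EuclideanSpace ℝ (Fin 3), Continuous fun r : ℝ => x₀ + r • m := fun m =>
    continuous_const.add (continuous_id.smul continuous_const)
  have hTm : ∀ m : EuclideanSpace ℝ (Fin 3), ‖m‖ = 1 → ContinuousOn (fun r : ℝ => T (x₀ + r • m)) (Icc R (2 * R)) := by
    intro m hm
    refine hT.continuousOn.comp (hpath m).continuousOn fun r hr => ?_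
    exact centre_add_smul_ne hm (lt_of_lt_of_le hR hr.1).ne'
  have hcont : ContinuousOn (fun r : ℝ => T (x₀ + r • n) - T (x₀ + r • n')) (Icc R (2 * R)) :=
    (hTm n hn).sub (hTm n' hn')
  have hne : (Icc R (2 * R)).Nonempty := ⟨R, le_rfl, by linarith⟩
  obtain ⟨r₀, hr₀, hmin⟩ := isCompact_Icc.exists_isMinOn hne hcont
  refine ⟨r₀, hr₀, ?_⟩
  -- the minimum value `μ` is attained everywhere as a lower bound, so `le_div_of_dyadicShell_ge` applies to it
  exact le_div_of_dyadicShell_ge hv hV hT hcurl hn hn' hR fun r hr => hmin hr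

end ShellMean

end Summit.NavierStokesRegularity.NavierStokesRegularity.Theorems.PoloidalLiouville.Antidynamo
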